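import Mathlib
import Summits.Ventures.PercRepro.TriangleCapFourCapArith

/-!
# PercRepro — THE TRIANGLE COUNT: three pairwise adjacent vertices of a `K₄⁻`-free graph have
`degIn N u + degIn N v + degIn N w ≤ |N| + 3` (p3, gen 49; part 205b′)

Each pair of the triangle shares at most one neighbour in `N` (`card_inter_le_one_of_adj`), so the three
`N`-neighbourhoods overlap in at most three vertices. Used at the corner `K = 8 + j` of the row `a = 4`, where the
three non-neighbours of a cap vertex are forced to be a triangle. Axioms: standard.
-/

namespace PercRepro

namespace TriangleCap

namespace C047

open Finset

variable {V : Type*} [Fintype V] [DecidableEq V]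

/-- `|A ∩ B| ≤ 1` for the `N`-neighbourhoods of two adjacent vertices (`K₄⁻`). -/
theorem card_filter_inter_le_one (D : SimpleGraph V) [DecidableRel D.Adj] (hK : K4mFree D) (N : Finset V)
    {y y' : V} (hyy' : D.Adj y y') :
    (N.filter (fun v => D.Adj y v) ∩ N.filter (fun v => D.Adj y' v)).card ≤ 1 := by
  have h := card_inter_le_one_of_adj D hK hyy'
  have hsub : N.filter (fun v => D.Adj y v) ∩ N.filter (fun v => D.Adj y' v) ⊆
      (univ.filter (fun v => D.Adj y v)) ∩ (univ.filter (fun v => D.Adj y' v)) := by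
    intro v hv
    rw [mem_inter, mem_filter, mem_filter] at hv
    rw [mem_inter, mem_filter, mem_filter]
    exact ⟨⟨mem_univ _, hv.1.2⟩, ⟨mem_univ _, hv.2.2⟩⟩
  exact (card_le_card hsub).trans h

/-- **THE TRIANGLE COUNT:** three pairwise adjacent vertices `u, v, w` of a `K₄⁻`-free graph have
`degIn N u + degIn N v + degIn N w ≤ |N| + 3` (each pair shares at most one neighbour in `N`). -/
theorem degIn_triangle_le (D : SimpleGraph V) [DecidableRel D.Adj] (hK : K4mFree D) (N : Finset V) {u v w : V}
    (huv : D.Adj u v) (huw : D.Adj u w) (hvw : D.Adj v w) :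
    degIn D N u + degIn D N v + degIn D N w ≤ N.card + 3 := by
  unfold degIn
  set A := N.filter (fun x => D.Adj u x) with hA
  set B := N.filter (fun x => D.Adj v x) with hB
  set C := N.filter (fun x => D.Adj w x) with hC
  have h1 := card_union_add_card_inter A B
  have h2 := card_union_add_card_inter (A ∪ B) C
  have h3 : ((A ∪ B) ∩ C).card ≤ (A ∩ C).card + (B ∩ C).card := by
    rw [union_inter_distrib_right]
    exact card_union_le _ _
  have h4 : (A ∪ B ∪ C).card ≤ N.card := by
    apply card_le_card
    intro x hx
    rw [mem_union, mem_union] at hx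
    rcases hx with (hx | hx) | hx
    · exact mem_of_mem_filter x hx
    · exact mem_of_mem_filter x hx
    · exact mem_of_mem_filter x hx
  have hAB := card_filter_inter_le_one D hK N huv
  have hAC := card_filter_inter_le_one D hK N huw
  have hBC := card_filter_inter_le_one D hK N hvw
  rw [← hA, ← hB] at hAB
  rw [← hA, ← hC] at hAC
  rw [← hB, ← hC] at hBC
  omega

end C047

end TriangleCap

end PercRepro
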